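import Summits.RiemannHypothesis.RiemannHypothesis.Theorems.WeilFormatCCinfRowCoeffBox
import Summits.RiemannHypothesis.RiemannHypothesis.Theorems.WeilFormatCCinfRowRemainderBox
import Summits.RiemannHypothesis.RiemannHypothesis.Theorems.WeilFormatCCinfImageRemainderBox
import Literature.NumberTheory.LFunctions.YoshidaWindowGramColumnData
import HarnessLib

/-!
# Format C, design C∞ (E2, data side): the TRUNCATED even row remainder `CinfFam.rhoRowE` — truncation-tail box and packed claim

Route context: Fourier–Galerkin / Schur-complement certificates of Weil positivity on a window ("format C", C∞ door
`weilPositivityOn_of_cinf_pipeline` / `_of_cinf_cert`; supporting stmt-RiemannHypothesis-0098; seat rh-explicit-weil-2, cell memos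
`…/rh-explicit-weil-2/gen16/E2F-CERT-PIPELINE.md` §2, `E2F-EMITTER-SPEC.md` §5).

The pipeline door (weil-10, `WeilFormatCCinfDoorPipeline`) instantiates the remainder `ρrow` with the TRUNCATED family package
`cinf_facts_even_truncA`: `CinfFam.rhoRowE a ν K R J D E₀ m₀ n` = the analytic remainder of `cinf_facts_even` (boxed by
`CinfPrimR.mem_evenRhoRowBox`, `WeilFormatCCinfCertPrimR`) PLUS the truncation tail
`Σ_{x : Fin 4 × Fin (D+1), E₀ < x.2} |P(n, x)|·τ(x.1)/m₀^{x.2}` (`τ = ![1, m₀, ΣΛ/√n, ΣΛ/√n]`, `P` the raw (tag, power)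
row coefficients).  This file boxes the tail from the landed per-fiber boxes (`CinfCoeff.mem_evenRowPureBox`, `mem_evenRowSinBox`;
tags 1, 2 are identically `0`) and `CinfCoeff.absBox`, adds the analytic box (`CinfCoeff.mem_evenRowRemBox`), and packs the claim:

* `CinfPrimRT.tagTailBox` / `mem_tagTailBox` — `Σ_{d ≤ D, E₀ < d} |g d|·τ/m₀^d` for one tag;
* `evenTailBox` / ★ `mem_evenTailBox` — the four-tag truncation tail, stated VERBATIM as printed in `CinfFam.rhoRowE`
  (with `a := (a : ℝ)` for the rung's rational `a`);
* `evenRhoRowTBox` / ★ `mem_evenRhoRowTBox` — box of the full truncated remainder (= `CinfFam.rhoRowE (a:ℝ) ν K R J D E₀ m₀ n`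
  by `rfl`);
* ★ `rhoRowTDataNear_even` — packed claim (layout `(n, 0)`, a `B × 1` table) from one `Encl.checkRect`.

Bookkeeping over landed evaluators; standard axioms; no RH claim.
-/

set_option autoImplicit false
-- `Summit.RiemannHypothesis.RiemannHypothesis.…` is the layout-mandated namespace (summit = problem name).
set_option linter.dupNamespace false

open Finset Complex
open scoped Real ArithmeticFunction.vonMangoldt

namespace Summit.RiemannHypothesis.RiemannHypothesis.Theorems.WeilFormatC

namespace CinfPrimRT

open Literature.NumberTheory.LFunctions Literature.NumberTheory.LFunctions.Yoshida1992 Literature.Analysis.SpecialFunctions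
open Literature.Analysis.ValidatedNumerics Literature.Analysis.ValidatedNumerics.NumericsMP
open CinfCoeff (RowInputs RowInputsValid evenRowPureBox evenRowSinBox evenRowRemBox mem_evenRowPureBox mem_evenRowSinBox
  mem_evenRowRemBox absBox mem_absBox)

variable {S : ℕ}

/-! ## Generic pieces -/

/-- The truncation tail of a four-tag family as four `range` sums (tags split, `Fin` index flattened). -/
private theorem tail_sum_eq (g₀ g₁ g₂ g₃ : ℕ → ℝ) (τ₀ τ₁ τ₂ τ₃ M : ℝ) (D E₀ : ℕ) :
    (∑ x : Fin 4 × Fin (D + 1), if E₀ < (x.2 : ℕ) then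
        |(fun t d ↦ (![g₀, g₁, g₂, g₃] t) d) x.1 x.2| * (![τ₀, τ₁, τ₂, τ₃] x.1) / M ^ (x.2 : ℕ) else 0)
      = (∑ d ∈ Finset.range (D + 1), if E₀ < d then |g₀ d| * τ₀ / M ^ d else 0)
        + (∑ d ∈ Finset.range (D + 1), if E₀ < d then |g₁ d| * τ₁ / M ^ d else 0)
        + (∑ d ∈ Finset.range (D + 1), if E₀ < d then |g₂ d| * τ₂ / M ^ d else 0)
        + (∑ d ∈ Finset.range (D + 1), if E₀ < d then |g₃ d| * τ₃ / M ^ d else 0) := by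
  rw [Fintype.sum_prod_type, Fin.sum_univ_four]
  simp only [Matrix.cons_val_zero, Matrix.cons_val_one, Matrix.cons_val, Finset.sum_range]

/-- `Σ_{j<n} f j` as a box (local copy of the `sumBox` idiom). -/
def sumBox (S : ℕ) (f : ℕ → MI) : ℕ → MI
  | 0 => MI.ofInt S 0
  | n + 1 => (sumBox S f n).add (f n)

/-- `sumBox ∋ Σ_{j<n} g j`. -/
theorem mem_sumBox (S : ℕ) {f : ℕ → MI} {g : ℕ → ℝ} :
    ∀ n : ℕ, (∀ j < n, MI.mem S (g j) (f j)) → MI.mem S (∑ j ∈ Finset.range n, g j) (sumBox S f n)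
  | 0, _ => by simpa [sumBox] using MI.mem_ofInt S 0
  | n + 1, h => by
      rw [Finset.sum_range_succ, sumBox]
      exact MI.mem_add (mem_sumBox S n fun j hj ↦ h j (by omega)) (h n (by omega))

/-- **One tag's truncation tail** `Σ_{d < D+1} (if E₀ < d then |g d|·τ/m₀^d else 0)` as a box. -/
def tagTailBox (S : ℕ) (G : ℕ → MI) (T : MI) (m₀ D E₀ : ℕ) : MI :=
  sumBox S (fun d ↦ if E₀ < d then ((absBox (G d)).mul S T).divNat (m₀ ^ d) else MI.ofInt S 0) (D + 1)

/-- `tagTailBox ∋` the tag's truncation tail. -/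
theorem mem_tagTailBox (hS : 0 < S) {g : ℕ → ℝ} {G : ℕ → MI} (hg : ∀ d, MI.mem S (g d) (G d)) {τ : ℝ} {T : MI}
    (hτ : MI.mem S τ T) {m₀ : ℕ} (hm₀ : 0 < m₀) (D E₀ : ℕ) :
    MI.mem S (∑ d ∈ Finset.range (D + 1), if E₀ < d then |g d| * τ / (m₀ : ℝ) ^ d else 0) (tagTailBox S G T m₀ D E₀) := by
  refine mem_sumBox S (D + 1) fun d _ ↦ ?_
  by_cases h : E₀ < d
  · rw [if_pos h, if_pos h]
    have h1 := MI.mem_divNat (MI.mem_mul hS (mem_absBox (hg d)) hτ) (pow_pos hm₀ d)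
    simpa only [Nat.cast_pow, mul_div_assoc] using h1
  · rw [if_neg h, if_neg h]
    simpa using MI.mem_ofInt S 0

/-! ## The even truncation tail -/

variable {a : ℚ} {X : ℕ → RowInputs} {ν K R J D E₀ m₀ : ℕ} {Lam RemS Rho : MI}

/-- **Box of the even truncation tail** of row `n`: tags `0` (pure fiber sums) and `3` (`S_m` fiber sums) from the landed
per-fiber boxes, tags `1, 2` identically zero; weights `![1, m₀, ΣΛ/√n, ΣΛ/√n]`. -/
def evenTailBox (S : ℕ) (X : ℕ → RowInputs) (Lam : MI) (a : ℚ) (ν K R J m₀ D E₀ n : ℕ) : MI :=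
  (((tagTailBox S (fun d ↦ evenRowPureBox S (X n) a n ν K R J d) (MI.ofInt S 1) m₀ D E₀).add
      (tagTailBox S (fun _ ↦ MI.ofInt S 0) (MI.ofInt S (m₀ : ℤ)) m₀ D E₀)).add
      (tagTailBox S (fun _ ↦ MI.ofInt S 0) Lam m₀ D E₀)).add
    (tagTailBox S (fun d ↦ evenRowSinBox S (X n) n J d) Lam m₀ D E₀)

/-- ★ **`evenTailBox ∋` the truncation tail of `CinfFam.rhoRowE`** (the `Σ_{x : Fin 4 × Fin (D+1)}` summand, verbatim with
`a := (a : ℝ)`). -/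
theorem mem_evenTailBox (hS : 0 < S) (ha : 0 < a) (hm₀ : 0 < m₀) {n : ℕ}
    (hX : RowInputsValid S a n ν R (1 / (1 + 4 * freq (a : ℝ) n ^ 2)) (X n))
    (hLam : MI.mem S (∑ k ∈ weilPrimeIndex (a : ℝ), (Λ k : ℝ) / Real.sqrt k) Lam) :
    MI.mem S
      (∑ x : Fin 4 × Fin (D + 1), if E₀ < (x.2 : ℕ) then
                |(fun t d ↦ (![fun d : ℕ ↦ (∑ j ∈ (Finset.range J).filter (fun j ↦ (2 * j + 1) = d),
                      π / 4 * ((-1 : ℝ) ^ n * (n : ℝ) ^ (2 * j)) / Real.pi)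
                    + (∑ p ∈ (Finset.Icc 1 K ×ˢ Finset.range J).filter (fun p ↦ p.1 + (2 * p.2 + 1) = d),
                        (fun N : ℕ ↦ (if N % 4 = 1 then (1 : ℝ) else if N % 4 = 3 then -1 else 0)
                    * (1 - 1 / (2 * (N : ℝ))
                        - (∑ l ∈ Finset.Icc 1 ν, (bernoulli (2 * l) : ℝ) / (2 * l) * 16 ^ l
                            * (((N - 1).choose (2 * l - 1) : ℕ) : ℝ)) / 2)
                    * ((a : ℝ) / (2 * π)) ^ N) p.1
                          * ((-1 : ℝ) ^ n * (n : ℝ) ^ (2 * p.2)) / Real.pi)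
                    - (∑ p ∈ (Finset.range R ×ˢ Finset.range J).filter (fun p ↦ (2 * p.1 + 1) + (2 * p.2 + 1) = d),
                        (fun r : ℕ ↦ (-1 : ℝ) ^ r *
                    (∑' l : ℕ, Real.exp (-(2 * (a : ℝ) * digammaNode l)) * digammaNode l ^ (2 * r)) * ((a : ℝ) / π) ^ (2 * r + 1)) p.1
                          * ((-1 : ℝ) ^ n * (n : ℝ) ^ (2 * p.2)) / Real.pi)
                    + (∑ r ∈ (Finset.range J).filter (fun r ↦ (2 * r + 2) = d),
                        (fun r : ℕ ↦ (-1 : ℝ) ^ n *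
                    (-((n : ℝ) ^ (2 * r + 1)) * ((Complex.digamma (1 / 4 + ((freq (a : ℝ) n : ℝ) : ℂ) / 2 * I)).im / 2
                        + (∑ k ∈ weilPrimeIndex (a : ℝ), (Λ k : ℝ) / Real.sqrt k * Real.sin (freq (a : ℝ) n * Real.log k))
                        - archExpSumSin (a : ℝ) n) / π
                      + 4 / (a : ℝ) * (Real.exp ((a : ℝ) / 2) - Real.exp (-((a : ℝ) / 2))) ^ 2 * (-1 : ℝ) ^ r * ((a : ℝ) ^ 2 / (4 * π ^ 2)) ^ (r + 1)
                        * (1 / (1 + 4 * freq (a : ℝ) n ^ 2)))) r),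
                      fun _ ↦ 0, fun _ ↦ 0,
                      fun d : ℕ ↦ ∑ j ∈ (Finset.range J).filter (fun j ↦ (2 * j + 1) = d),
                      ((-1 : ℝ) ^ n * (n : ℝ) ^ (2 * j)) / Real.pi] t) d) x.1 x.2| * (![(1 : ℝ), (m₀ : ℝ), ∑ n ∈ weilPrimeIndex (a : ℝ), (Λ n : ℝ) / Real.sqrt n, ∑ n ∈ weilPrimeIndex (a : ℝ), (Λ n : ℝ) / Real.sqrt n] x.1) / (m₀ : ℝ) ^ (x.2 : ℕ) else 0)
      (evenTailBox S X Lam a ν K R J m₀ D E₀ n) := by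
  rw [tail_sum_eq, evenTailBox]
  refine MI.mem_add (MI.mem_add (MI.mem_add ?_ ?_) ?_) ?_
  · exact mem_tagTailBox hS (fun d ↦ mem_evenRowPureBox hS ha hX K J d) (by exact_mod_cast MI.mem_ofInt S 1) hm₀ D E₀
  · exact mem_tagTailBox hS (fun _ ↦ by exact_mod_cast MI.mem_ofInt S 0) (by exact_mod_cast MI.mem_ofInt S (m₀ : ℤ)) hm₀ D E₀
  · exact mem_tagTailBox hS (fun _ ↦ by exact_mod_cast MI.mem_ofInt S 0) hLam hm₀ D E₀
  · exact mem_tagTailBox hS (fun d ↦ mem_evenRowSinBox hX J d) hLam hm₀ D E₀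

/-! ## The full truncated remainder -/

/-- **Box of `CinfFam.rhoRowE (a:ℝ) ν K R J D E₀ m₀ n`**: analytic remainder (`CinfCoeff.evenRowRemBox`) plus truncation tail. -/
def evenRhoRowTBox (S : ℕ) (X : ℕ → RowInputs) (RemS Lam Rho : MI) (a : ℚ) (ν K R J m₀ D E₀ n : ℕ) : MI :=
  (evenRowRemBox S RemS (X n).P (X n).Pinv Lam Rho (X n).S2 (X n).QQ (X n).Ci a n m₀ J).add
    (evenTailBox S X Lam a ν K R J m₀ D E₀ n)

/-- ★ **`evenRhoRowTBox ∋ CinfFam.rhoRowE (a:ℝ) ν K R J D E₀ m₀ n`** (the door's truncated even row remainder, printed verbatim;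
inputs: the row's `RowInputs`, `RemS ∋` the Stirling/node bracket, `Lam ∋ Σ Λ(k)/√k`, `Rho ∋ ρ(2a)`). -/
theorem mem_evenRhoRowTBox (hS : 0 < S) (ha : 0 < a) (hm₀ : 0 < m₀) {n : ℕ}
    (hX : RowInputsValid S a n ν R (1 / (1 + 4 * freq (a : ℝ) n ^ 2)) (X n))
    (hRemS : MI.mem S
      ((4 * Real.pi ^ 2 / 3 * ((2 * ν + 1).factorial : ℝ) / (2 * Real.pi) ^ (2 * ν + 1)
                  * (4 * (1 / (4 * (π * m₀ / (a : ℝ) / 2)))) ^ (2 * ν)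
                + (1 / (4 * (π * m₀ / (a : ℝ) / 2))) ^ (K + 1) / ((K + 1) * (1 - 1 / (4 * (π * m₀ / (a : ℝ) / 2))))
                + 2 * (1 / (4 * (π * m₀ / (a : ℝ) / 2))) ^ (K + 1)
                + ∑ k ∈ Finset.Icc 1 ν, |(bernoulli (2 * k) : ℝ) / (2 * k)| * 2 ^ (K + 1 + 4 * k)
                    * (1 / (4 * (π * m₀ / (a : ℝ) / 2))) ^ (K + 1)) / 2
              + (∑' k : ℕ, Real.exp (-(2 * (a : ℝ) * digammaNode k)) * digammaNode k ^ (2 * R))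
                  / |π * m₀ / (a : ℝ)| ^ (2 * R + 1)) RemS)
    (hLam : MI.mem S (∑ k ∈ weilPrimeIndex (a : ℝ), (Λ k : ℝ) / Real.sqrt k) Lam)
    (hRho : MI.mem S (weilArchDensity (2 * (a : ℝ))) Rho) :
    MI.mem S
      ((((4 * Real.pi ^ 2 / 3 * ((2 * ν + 1).factorial : ℝ) / (2 * Real.pi) ^ (2 * ν + 1)
                       * (4 * (1 / (4 * (π * m₀ / (a : ℝ) / 2)))) ^ (2 * ν)
                     + (1 / (4 * (π * m₀ / (a : ℝ) / 2))) ^ (K + 1) / ((K + 1) * (1 - 1 / (4 * (π * m₀ / (a : ℝ) / 2))))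
                     + 2 * (1 / (4 * (π * m₀ / (a : ℝ) / 2))) ^ (K + 1)
                     + ∑ k ∈ Finset.Icc 1 ν, |(bernoulli (2 * k) : ℝ) / (2 * k)| * 2 ^ (K + 1 + 4 * k)
                         * (1 / (4 * (π * m₀ / (a : ℝ) / 2))) ^ (K + 1)) / 2
                   + (∑' k : ℕ, Real.exp (-(2 * (a : ℝ) * digammaNode k)) * digammaNode k ^ (2 * R))
                       / |π * m₀ / (a : ℝ)| ^ (2 * R + 1)) / π
                   * ∑ j ∈ Finset.range J, (n : ℝ) ^ (2 * j) / (m₀ : ℝ) ^ (2 * j + 1)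
                 + (2 * (π / 4 + (∑ k ∈ weilPrimeIndex (a : ℝ), (Λ k : ℝ) / Real.sqrt k) + (a : ℝ) * (1 + weilArchDensity (2 * (a : ℝ))) / π)
                       * (n : ℝ) ^ (2 * J) / π
                     + 4 / (a : ℝ) * (Real.exp ((a : ℝ) / 2) - Real.exp (-((a : ℝ) / 2))) ^ 2 * ((a : ℝ) ^ 2 / (4 * π ^ 2)) ^ (J + 1)
                       * (1 / (1 + 4 * freq (a : ℝ) n ^ 2))) / (m₀ : ℝ) ^ (2 * J + 1))
        + ∑ x : Fin 4 × Fin (D + 1), if E₀ < (x.2 : ℕ) then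
                  |(fun t d ↦ (![fun d : ℕ ↦ (∑ j ∈ (Finset.range J).filter (fun j ↦ (2 * j + 1) = d),
                        π / 4 * ((-1 : ℝ) ^ n * (n : ℝ) ^ (2 * j)) / Real.pi)
                      + (∑ p ∈ (Finset.Icc 1 K ×ˢ Finset.range J).filter (fun p ↦ p.1 + (2 * p.2 + 1) = d),
                          (fun N : ℕ ↦ (if N % 4 = 1 then (1 : ℝ) else if N % 4 = 3 then -1 else 0)
                      * (1 - 1 / (2 * (N : ℝ))
                          - (∑ l ∈ Finset.Icc 1 ν, (bernoulli (2 * l) : ℝ) / (2 * l) * 16 ^ l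
                              * (((N - 1).choose (2 * l - 1) : ℕ) : ℝ)) / 2)
                      * ((a : ℝ) / (2 * π)) ^ N) p.1
                            * ((-1 : ℝ) ^ n * (n : ℝ) ^ (2 * p.2)) / Real.pi)
                      - (∑ p ∈ (Finset.range R ×ˢ Finset.range J).filter (fun p ↦ (2 * p.1 + 1) + (2 * p.2 + 1) = d),
                          (fun r : ℕ ↦ (-1 : ℝ) ^ r *
                      (∑' l : ℕ, Real.exp (-(2 * (a : ℝ) * digammaNode l)) * digammaNode l ^ (2 * r)) * ((a : ℝ) / π) ^ (2 * r + 1)) p.1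
                            * ((-1 : ℝ) ^ n * (n : ℝ) ^ (2 * p.2)) / Real.pi)
                      + (∑ r ∈ (Finset.range J).filter (fun r ↦ (2 * r + 2) = d),
                          (fun r : ℕ ↦ (-1 : ℝ) ^ n *
                      (-((n : ℝ) ^ (2 * r + 1)) * ((Complex.digamma (1 / 4 + ((freq (a : ℝ) n : ℝ) : ℂ) / 2 * I)).im / 2
                          + (∑ k ∈ weilPrimeIndex (a : ℝ), (Λ k : ℝ) / Real.sqrt k * Real.sin (freq (a : ℝ) n * Real.log k))
                          - archExpSumSin (a : ℝ) n) / π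
                        + 4 / (a : ℝ) * (Real.exp ((a : ℝ) / 2) - Real.exp (-((a : ℝ) / 2))) ^ 2 * (-1 : ℝ) ^ r * ((a : ℝ) ^ 2 / (4 * π ^ 2)) ^ (r + 1)
                          * (1 / (1 + 4 * freq (a : ℝ) n ^ 2)))) r),
                        fun _ ↦ 0, fun _ ↦ 0,
                        fun d : ℕ ↦ ∑ j ∈ (Finset.range J).filter (fun j ↦ (2 * j + 1) = d),
                        ((-1 : ℝ) ^ n * (n : ℝ) ^ (2 * j)) / Real.pi] t) d) x.1 x.2| * (![(1 : ℝ), (m₀ : ℝ), ∑ n ∈ weilPrimeIndex (a : ℝ), (Λ n : ℝ) / Real.sqrt n, ∑ n ∈ weilPrimeIndex (a : ℝ), (Λ n : ℝ) / Real.sqrt n] x.1) / (m₀ : ℝ) ^ (x.2 : ℕ) else 0)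
      (evenRhoRowTBox S X RemS Lam Rho a ν K R J m₀ D E₀ n) := by
  have h1 := mem_evenRowRemBox hS ha hm₀ J hRemS hX.hP hX.hPinv hLam hRho hX.hS2 hX.hQQ hX.hCi (i := n)
  have h2 := mem_evenTailBox (K := K) (J := J) (D := D) (E₀ := E₀) hS ha hm₀ hX hLam
  have h := MI.mem_add h1 h2
  rw [evenRhoRowTBox]
  convert h using 2

/-! ## Packed claim -/

/-- Local copy of `CinfPrimV.dataNear_of_checkRect`: any evaluator with `f i t ∈ box i t` and one passing `Encl.checkRect`
give `Encl.DataNear f n K w o c ρ XP`. -/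
private theorem dataNear_of_checkRect (hS : 0 < S) {f : ℕ → ℕ → ℝ} {box : ℕ → ℕ → MI} {n K w o c ρ : ℕ} {XP : List ℕ}
    (hbox : ∀ i < n, ∀ t < K, MI.mem S (f i t) (box i t))
    (h : Encl.checkRect S c (ρ : ℤ) w K o box XP 0 n 0 K = true) : Encl.DataNear f n K w o c ρ XP := by
  have h0 : Encl.DataNear f (0 + n) K w o c ρ XP :=
    Encl.DataNear.extendRows Encl.DataNear.zeroRows fun i _ hi t ht ↦ by
      have h2 := Encl.near_of_checkRect hS (f := f)
        (fun i _ hi t _ ht ↦ hbox i (by simpa using hi) t (by simpa using ht)) h (Nat.zero_le i) hi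
        (Nat.zero_le t) (by simpa using ht)
      exact_mod_cast h2
  simpa using h0

variable {B : ℕ}

/-- ★ **Packed claim of the truncated even row remainders** `CinfFam.rhoRowE (a:ℝ) ν K R J D E₀ m₀ n`, layout `(n, 0)`
(a `B × 1` table; `CinfBlocks.VecNear.col0` makes it the vector `RR` of the remainder stage). -/
theorem rhoRowTDataNear_even (hS : 0 < S) (ha : 0 < a) (hm₀ : 0 < m₀)
    (hX : ∀ n < B, RowInputsValid S a n ν R (1 / (1 + 4 * freq (a : ℝ) n ^ 2)) (X n))
    (hRemS : MI.mem S
      ((4 * Real.pi ^ 2 / 3 * ((2 * ν + 1).factorial : ℝ) / (2 * Real.pi) ^ (2 * ν + 1)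
                  * (4 * (1 / (4 * (π * m₀ / (a : ℝ) / 2)))) ^ (2 * ν)
                + (1 / (4 * (π * m₀ / (a : ℝ) / 2))) ^ (K + 1) / ((K + 1) * (1 - 1 / (4 * (π * m₀ / (a : ℝ) / 2))))
                + 2 * (1 / (4 * (π * m₀ / (a : ℝ) / 2))) ^ (K + 1)
                + ∑ k ∈ Finset.Icc 1 ν, |(bernoulli (2 * k) : ℝ) / (2 * k)| * 2 ^ (K + 1 + 4 * k)
                    * (1 / (4 * (π * m₀ / (a : ℝ) / 2))) ^ (K + 1)) / 2
              + (∑' k : ℕ, Real.exp (-(2 * (a : ℝ) * digammaNode k)) * digammaNode k ^ (2 * R))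
                  / |π * m₀ / (a : ℝ)| ^ (2 * R + 1)) RemS)
    (hLam : MI.mem S (∑ k ∈ weilPrimeIndex (a : ℝ), (Λ k : ℝ) / Real.sqrt k) Lam)
    (hRho : MI.mem S (weilArchDensity (2 * (a : ℝ))) Rho) {w o cc ρ : ℕ} {XP : List ℕ}
    (h : Encl.checkRect S cc (ρ : ℤ) w 1 o (fun n _ ↦ evenRhoRowTBox S X RemS Lam Rho a ν K R J m₀ D E₀ n) XP 0 B 0 1 = true) :
    Encl.DataNear (fun n _ ↦ (fun n : ℕ ↦ (((4 * Real.pi ^ 2 / 3 * ((2 * ν + 1).factorial : ℝ) / (2 * Real.pi) ^ (2 * ν + 1)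
                        * (4 * (1 / (4 * (π * m₀ / (a : ℝ) / 2)))) ^ (2 * ν)
                      + (1 / (4 * (π * m₀ / (a : ℝ) / 2))) ^ (K + 1) / ((K + 1) * (1 - 1 / (4 * (π * m₀ / (a : ℝ) / 2))))
                      + 2 * (1 / (4 * (π * m₀ / (a : ℝ) / 2))) ^ (K + 1)
                      + ∑ k ∈ Finset.Icc 1 ν, |(bernoulli (2 * k) : ℝ) / (2 * k)| * 2 ^ (K + 1 + 4 * k)
                          * (1 / (4 * (π * m₀ / (a : ℝ) / 2))) ^ (K + 1)) / 2
                    + (∑' k : ℕ, Real.exp (-(2 * (a : ℝ) * digammaNode k)) * digammaNode k ^ (2 * R))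
                        / |π * m₀ / (a : ℝ)| ^ (2 * R + 1)) / π
                    * ∑ j ∈ Finset.range J, (n : ℝ) ^ (2 * j) / (m₀ : ℝ) ^ (2 * j + 1)
                  + (2 * (π / 4 + (∑ k ∈ weilPrimeIndex (a : ℝ), (Λ k : ℝ) / Real.sqrt k) + (a : ℝ) * (1 + weilArchDensity (2 * (a : ℝ))) / π)
                        * (n : ℝ) ^ (2 * J) / π
                      + 4 / (a : ℝ) * (Real.exp ((a : ℝ) / 2) - Real.exp (-((a : ℝ) / 2))) ^ 2 * ((a : ℝ) ^ 2 / (4 * π ^ 2)) ^ (J + 1)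
                        * (1 / (1 + 4 * freq (a : ℝ) n ^ 2))) / (m₀ : ℝ) ^ (2 * J + 1))
        + ∑ x : Fin 4 × Fin (D + 1), if E₀ < (x.2 : ℕ) then
                  |(fun t d ↦ (![fun d : ℕ ↦ (∑ j ∈ (Finset.range J).filter (fun j ↦ (2 * j + 1) = d),
                        π / 4 * ((-1 : ℝ) ^ n * (n : ℝ) ^ (2 * j)) / Real.pi)
                      + (∑ p ∈ (Finset.Icc 1 K ×ˢ Finset.range J).filter (fun p ↦ p.1 + (2 * p.2 + 1) = d),
                          (fun N : ℕ ↦ (if N % 4 = 1 then (1 : ℝ) else if N % 4 = 3 then -1 else 0)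
                      * (1 - 1 / (2 * (N : ℝ))
                          - (∑ l ∈ Finset.Icc 1 ν, (bernoulli (2 * l) : ℝ) / (2 * l) * 16 ^ l
                              * (((N - 1).choose (2 * l - 1) : ℕ) : ℝ)) / 2)
                      * ((a : ℝ) / (2 * π)) ^ N) p.1
                            * ((-1 : ℝ) ^ n * (n : ℝ) ^ (2 * p.2)) / Real.pi)
                      - (∑ p ∈ (Finset.range R ×ˢ Finset.range J).filter (fun p ↦ (2 * p.1 + 1) + (2 * p.2 + 1) = d),
                          (fun r : ℕ ↦ (-1 : ℝ) ^ r *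
                      (∑' l : ℕ, Real.exp (-(2 * (a : ℝ) * digammaNode l)) * digammaNode l ^ (2 * r)) * ((a : ℝ) / π) ^ (2 * r + 1)) p.1
                            * ((-1 : ℝ) ^ n * (n : ℝ) ^ (2 * p.2)) / Real.pi)
                      + (∑ r ∈ (Finset.range J).filter (fun r ↦ (2 * r + 2) = d),
                          (fun r : ℕ ↦ (-1 : ℝ) ^ n *
                      (-((n : ℝ) ^ (2 * r + 1)) * ((Complex.digamma (1 / 4 + ((freq (a : ℝ) n : ℝ) : ℂ) / 2 * I)).im / 2
                          + (∑ k ∈ weilPrimeIndex (a : ℝ), (Λ k : ℝ) / Real.sqrt k * Real.sin (freq (a : ℝ) n * Real.log k))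
                          - archExpSumSin (a : ℝ) n) / π
                        + 4 / (a : ℝ) * (Real.exp ((a : ℝ) / 2) - Real.exp (-((a : ℝ) / 2))) ^ 2 * (-1 : ℝ) ^ r * ((a : ℝ) ^ 2 / (4 * π ^ 2)) ^ (r + 1)
                          * (1 / (1 + 4 * freq (a : ℝ) n ^ 2)))) r),
                        fun _ ↦ 0, fun _ ↦ 0,
                        fun d : ℕ ↦ ∑ j ∈ (Finset.range J).filter (fun j ↦ (2 * j + 1) = d),
                        ((-1 : ℝ) ^ n * (n : ℝ) ^ (2 * j)) / Real.pi] t) d) x.1 x.2| * (![(1 : ℝ), (m₀ : ℝ), ∑ n ∈ weilPrimeIndex (a : ℝ), (Λ n : ℝ) / Real.sqrt n, ∑ n ∈ weilPrimeIndex (a : ℝ), (Λ n : ℝ) / Real.sqrt n] x.1) / (m₀ : ℝ) ^ (x.2 : ℕ) else 0) n) B 1 w o cc ρ XP :=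
  dataNear_of_checkRect hS (fun n hn _ _ ↦ mem_evenRhoRowTBox hS ha hm₀ (hX n hn) hRemS hLam hRho) h

end CinfPrimRT

end Summit.RiemannHypothesis.RiemannHypothesis.Theorems.WeilFormatC
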